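import Literature.NumberTheory.NumberFields.UnramifiedHomsClassGroupPRankBound
import Literature.NumberTheory.EllipticCurves.H1UnramifiedFinite
import Literature.NumberTheory.EllipticCurves.ZpExtensionUnramifiedProofs
import Literature.NumberTheory.EllipticCurves.FineSelmerTorsionCoefficientsFiniteProofs
import Literature.NumberTheory.GaloisRepresentations.DecompositionGroupOfCompletion
import Literature.NumberTheory.GaloisRepresentations.IntegralGaloisActionProofs
import HarnessLib

/-!
# Everywhere-unramified homomorphisms on `Gal(K̄/L·K_∞)` with values in a `p`-torsion group are FINITE when
# the `p`-ranks of the class groups of the layers `L·K_n` are bounded (proved; no definition, no named fact)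

`Proofs`-style file in topic `NumberTheory/IwasawaTheory` (namespace
`Literature.NumberTheory.IwasawaTheory.UnramifiedHomsZpTowerFinite`), written by the prover seat
`bsd-potss-k8t-c4` g21 (cell `bsd-potss`, K8-t′ route, item stmt-BirchSwinnertonDyer-19982; closes nothing).
Third brick of the discharge, in bounded-`p`-rank form, of Coates–Sujatha 2005 Thm. 3.4.

Setting: `K` a number field, `p` an odd prime, `κ` a `ℤ_p`-extension of `K` (`H = ker κ = Gal(K̄/K_∞)`,
layers `κ.layerSubgroup n = Gal(K̄/K_n)`), `N ≤ Γ_K` an open normal subgroup (`= Gal(K̄/L)`, `L/K` finite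
Galois), `U_n = N ⊓ Gal(K̄/K_n) = Gal(K̄/L·K_n)`, `U_∞ = N ⊓ H`, and `M` a finite discrete abelian group with
`p·M = 0`.  `Hom(U, M; ∅)` is the tree's `unramifiedHoms U M ∅` (continuous additive maps killing
`U ∩ I_𝔓` for every prime `𝔓` of `\bar ℤ_K`).

* §1 `exists_openNormalSubgroup_forall_apply_eq_zero` — finitely many `f ∈ Hom(U_∞, M; ∅)` vanish on
  `U_∞ ∩ V` for some open normal `V ≤ Γ_K` (continuity; open normal subgroups form a basis at `1` of the
  profinite `Γ_K`, Mathlib `exist_openNormalSubgroup_sub_open_nhds_of_one`).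
* §2 `exists_level_forall_exists_mul_inv_mem` — for an open normal `V`, at every layer `m ≥ t` each
  `u ∈ U_m` is `u' v` with `u' ∈ U_∞`, `v ∈ V ∩ N` (the closed subgroup `κ(V ∩ N) ⊆ ℤ_p` contains
  `p^t ℤ_p`, tree `pow_valuation_mul_mem_of_isClosed`).
* §3 `exists_extension` — hence `f` EXTENDS to an additive `g : U_m → M` killing `V ∩ U_m`, with `g = f` on
  `U_∞`.
* §4 `extension_unramified` — `g` kills `U_m ∩ I_𝔓` for `𝔓 ∤ p` (`I_𝔓 ≤ H`, Washington Prop. 13.2 = tree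
  `ZpExtension.inertia_le_kerSubgroup_holds`) and, for `m` beyond a layer depending only on the finitely many
  places above `p`, also for `𝔓 ∣ p`: there `κ(U_m ∩ I_𝔓) ⊆ p·κ(U_t ∩ I_𝔓)`, so `g(j) = p·g(j₁) + f(h) = 0`
  (`p·M = 0`, `h ∈ U_∞ ∩ I_𝔓`).
* §5 **`unramifiedHoms_finite_of_index_le`** — if `[Cl(L·K_n) : Cl(L·K_n)^p] ≤ C` for all `n` then
  `Hom(U_∞, M; ∅)` is finite with at most `#M ^ C` elements: `f ↦ g|_{U_{m*}}` is injective and the sibling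
  CFT count `UnramifiedHomsClassGroupPRankBound.card_le_pow_index_of_unramified` bounds the image.

With `FineSelmerTrivialisingRestriction.finite_fineSelmerInfty_of_finite_unramifiedHoms` and the Lim–Sujatha
bricks this is Coates–Sujatha's Thm. 3.4 in the form «`rank_p Cl` bounded along the cyclotomic tower of
`K(E[p])` ⟹ statement (A)» (assembled in the `EllipticCurves` sibling).

References: [CoatesSujatha2005] Thm. 3.4 (and its proof); [KuriharaPollack2007] §3.1; [Washington1997] §13.1
(Prop. 13.2, Lemma 13.3: `ℤ_p`-extensions are unramified outside `p`, eventually totally ramified);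
[SerreGaloisCohomology1997] I.§2.2 Prop. 8 (cohomology of a projective limit).
-/

set_option autoImplicit false

noncomputable section

open scoped Classical Pointwise NumberField
open NumberField IsDedekindDomain Field IntermediateField

namespace Literature.NumberTheory.IwasawaTheory.UnramifiedHomsZpTowerFinite

open Literature.NumberTheory.EllipticCurves Literature.NumberTheory.GaloisRepresentations
  Literature.NumberTheory.NumberFields

variable {K : Type} [Field K] [NumberField K] {p : ℕ} [Fact p.Prime] (κ : ZpExtension K p)
  (N : Subgroup (absoluteGaloisGroup K))

/-! ## §1 A common open normal subgroup on which finitely many continuous maps vanish -/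

omit [NumberField K] in
/-- Finitely many continuous additive maps `f : U → M` (`U ≤ Γ_K` any subgroup, `M` discrete) vanish on
`U ∩ V` for a common OPEN NORMAL subgroup `V` of `Γ_K` (`K` of characteristic zero, so that `Γ_K` is
profinite: open normal subgroups form a basis of neighbourhoods of `1`).
[cite: SerreGaloisCohomology1997, I.§1.1 (profinite groups: open normal subgroups form a basis at 1)] -/
theorem exists_openNormalSubgroup_forall_apply_eq_zero [CharZero K] (U : Subgroup (absoluteGaloisGroup K))
    (M : Type) [AddCommGroup M] [TopologicalSpace M] [DiscreteTopology M]
    (T : Finset (U → M)) (hcont : ∀ f ∈ T, Continuous f) (hone : ∀ f ∈ T, f 1 = 0) :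
    ∃ V : OpenNormalSubgroup (absoluteGaloisGroup K),
      ∀ f ∈ T, ∀ u : U, (u : absoluteGaloisGroup K) ∈ (V : Subgroup (absoluteGaloisGroup K)) → f u = 0 := by
  -- for each `f`, an open set of `Γ_K` cutting out `f ⁻¹ {0}` on `U`
  have hO : ∀ f ∈ T, ∃ O : Set (absoluteGaloisGroup K), IsOpen O ∧ (1 : absoluteGaloisGroup K) ∈ O ∧
      ∀ u : U, (u : absoluteGaloisGroup K) ∈ O → f u = 0 := by
    intro f hf
    have hopen : IsOpen (f ⁻¹' {0}) := (hcont f hf).isOpen_preimage _ (isOpen_discrete _)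
    obtain ⟨O, hOopen, hOeq⟩ := isOpen_induced_iff.mp hopen
    refine ⟨O, hOopen, ?_, fun u hu => ?_⟩
    · have : (1 : U) ∈ Subtype.val ⁻¹' O := by rw [hOeq]; exact hone f hf
      exact this
    · have : u ∈ Subtype.val ⁻¹' O := hu
      rw [hOeq] at this
      exact this
  choose! O hOopen hO1 hOf using hO
  set O' : Set (absoluteGaloisGroup K) := ⋂ f ∈ T, O f with hO'
  have hO'open : IsOpen O' := isOpen_biInter_finset fun f hf => hOopen f hf
  have hO'1 : (1 : absoluteGaloisGroup K) ∈ O' := Set.mem_iInter₂.2 fun f hf => hO1 f hf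
  obtain ⟨V, hV⟩ := ProfiniteGrp.exist_openNormalSubgroup_sub_open_nhds_of_one hO'open hO'1
  exact ⟨V, fun f hf u hu => hOf f hf u (Set.mem_iInter₂.1 (hV hu) f hf)⟩

/-! ## §2 Beyond some layer, `U_m = U_∞ · (V ∩ N)` -/

omit [NumberField K] in
/-- For an open subgroup `V` of `Γ_K` (`K` of characteristic zero) there is a layer `t` such that for every
`m ≥ t` and every `u ∈ N` in the `m`-th layer subgroup `κ⁻¹(p^m ℤ_p)` there is `v ∈ V ∩ N` with
`κ v = κ u` (so `u v⁻¹ ∈ N ∩ ker κ`): the image `κ(V ∩ N)` is a closed subgroup of `ℤ_p` containing a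
non-zero element (a power of a topological generator lies in the finite-index subgroup `V ∩ N`), hence it
contains `p^t ℤ_p`. [cite: Washington1997, §13.1 (closed subgroups of `ℤ_p` are `0` and `p^n ℤ_p`; Lemma 13.3)] -/
theorem exists_level_forall_exists_apply_eq [CharZero K] [hNn : N.Normal]
    (hN : IsOpen (N : Set (absoluteGaloisGroup K)))
    (V : Subgroup (absoluteGaloisGroup K)) [hVn : V.Normal] (hV : IsOpen (V : Set (absoluteGaloisGroup K))) :
    ∃ t : ℕ, ∀ m, t ≤ m → ∀ u ∈ N ⊓ κ.layerSubgroup m,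
      ∃ v ∈ V ⊓ N, κ v = κ u := by
  -- a topological generator `γ` and a power of it in the open subgroup `V ⊓ N`
  obtain ⟨γ, hγ⟩ := κ.surjective (Multiplicative.ofAdd 1)
  have hVNopen : IsOpen ((V ⊓ N : Subgroup (absoluteGaloisGroup K)) : Set (absoluteGaloisGroup K)) :=
    hV.inter hN
  haveI : Finite (absoluteGaloisGroup K ⧸ (V ⊓ N)) := Subgroup.quotient_finite_of_isOpen _ hVNopen
  obtain ⟨k, hkpos, hk⟩ := (isOfFinOrder_of_finite (QuotientGroup.mk γ : absoluteGaloisGroup K ⧸ (V ⊓ N))).exists_pow_eq_one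
  have hγk : γ ^ k ∈ V ⊓ N := by
    rw [← QuotientGroup.eq_one_iff, QuotientGroup.mk_pow]; exact hk
  -- the closed subgroup `Z = κ(V ⊓ N)` of `ℤ_p`
  let Z : AddSubgroup ℤ_[p] :=
    AddSubgroup.toSubgroup.symm ((V ⊓ N).map (κ.toContinuousMonoidHom : absoluteGaloisGroup K →* Multiplicative ℤ_[p]))
  have hZmem : ∀ y : ℤ_[p], y ∈ Z ↔ ∃ δ ∈ V ⊓ N, κ δ = Multiplicative.ofAdd y := fun y ↦ by
    change Multiplicative.ofAdd y ∈ (V ⊓ N).map _ ↔ _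
    rw [Subgroup.mem_map]
    rfl
  have hZclosed : IsClosed (Z : Set ℤ_[p]) := by
    have hc : IsCompact (((V ⊓ N).map
        (κ.toContinuousMonoidHom : absoluteGaloisGroup K →* Multiplicative ℤ_[p]) :
        Subgroup (Multiplicative ℤ_[p])) : Set (Multiplicative ℤ_[p])) := by
      rw [Subgroup.coe_map]
      exact ((Subgroup.isClosed_of_isOpen _ hVNopen).isCompact).image κ.toContinuousMonoidHom.continuous
    exact hc.isClosed
  -- the non-zero element `k = κ(γ^k)` of `Z`
  set u : ℤ_[p] := (κ (γ ^ k)).toAdd with hudef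
  have hγ' : κ γ = Multiplicative.ofAdd 1 := hγ
  have hu_eq : u = (k : ℤ_[p]) := by
    rw [hudef, map_pow, hγ', ← ofAdd_nsmul, toAdd_ofAdd, nsmul_eq_mul, mul_one]
  have hu0 : u ≠ 0 := by
    rw [hu_eq]; exact_mod_cast hkpos.ne'
  have huZ : u ∈ Z := (hZmem u).mpr ⟨γ ^ k, hγk, by rw [hudef, ofAdd_toAdd]⟩
  refine ⟨u.valuation, fun m hm w hw => ?_⟩
  obtain ⟨hwN, hwm⟩ := Subgroup.mem_inf.1 hw
  rw [ZpExtension.mem_layerSubgroup] at hwm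
  obtain ⟨z, hz⟩ := hwm
  have hmem : (κ w).toAdd ∈ Z := by
    rw [hz, ← Nat.add_sub_cancel' hm, pow_add, mul_assoc]
    exact FineSelmerCoefficientMap.pow_valuation_mul_mem_of_isClosed Z hZclosed huZ hu0 _
  obtain ⟨δ, hδ, hδeq⟩ := (hZmem _).1 hmem
  exact ⟨δ, hδ, by rw [hδeq, ofAdd_toAdd]⟩

/-! ## §3 Extension of a homomorphism from `U_∞` to `U_m` -/

omit [NumberField K] in
/-- **Extension lemma.** Let `V ≤ Γ_K` be a normal subgroup, `f : N ⊓ ker κ → M` additive and vanishing on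
`V`, and `m` a layer at which every `u ∈ N ⊓ κ⁻¹(p^m ℤ_p)` has some `v ∈ V ⊓ N` with `κ v = κ u` (§2). Then
there is an additive `g : N ⊓ κ⁻¹(p^m ℤ_p) → M` with `g u = f u'` whenever `u = u' v` (`u' ∈ N ⊓ ker κ`,
`v ∈ V`); in particular `g` extends `f` and kills `V`. (Continuity of cohomology of profinite groups:
`Hom(∩ U_m, M) = lim Hom(U_m, M)` for finite `M`.) [cite: SerreGaloisCohomology1997, I.§2.2 Prop. 8] -/
theorem exists_extension (V : Subgroup (absoluteGaloisGroup K)) [hVn : V.Normal]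
    (M : Type) [AddCommGroup M] (f : ↥(N ⊓ κ.kerSubgroup) → M)
    (hfadd : ∀ a b, f (a * b) = f a + f b)
    (hfV : ∀ a : ↥(N ⊓ κ.kerSubgroup), (a : absoluteGaloisGroup K) ∈ V → f a = 0)
    (m : ℕ) (hm : ∀ u ∈ N ⊓ κ.layerSubgroup m, ∃ v ∈ V ⊓ N, κ v = κ u) :
    ∃ g : ↥(N ⊓ κ.layerSubgroup m) → M,
      (∀ a b, g (a * b) = g a + g b) ∧
      (∀ (u : ↥(N ⊓ κ.layerSubgroup m)) (u' : ↥(N ⊓ κ.kerSubgroup)),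
        (u : absoluteGaloisGroup K) * (u' : absoluteGaloisGroup K)⁻¹ ∈ V → g u = f u') := by
  -- choice of the `V`-component
  have hdec : ∀ u : ↥(N ⊓ κ.layerSubgroup m), ∃ u' : ↥(N ⊓ κ.kerSubgroup),
      (u : absoluteGaloisGroup K) * (u' : absoluteGaloisGroup K)⁻¹ ∈ V := by
    intro u
    obtain ⟨v, hv, hvu⟩ := hm u u.2
    obtain ⟨hvV, hvN⟩ := Subgroup.mem_inf.1 hv
    refine ⟨⟨v⁻¹ * u, Subgroup.mem_inf.2 ⟨mul_mem (inv_mem hvN) (Subgroup.mem_inf.1 u.2).1, ?_⟩⟩, ?_⟩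
    · rw [ZpExtension.mem_kerSubgroup, map_mul, map_inv, hvu, inv_mul_cancel]
    · simp only [mul_inv_rev, inv_inv, mul_inv_cancel_left]
      exact hvV
  choose s hs using hdec
  -- `f` only depends on the class modulo `V`
  have hwd : ∀ (u₁ u₂ : ↥(N ⊓ κ.kerSubgroup)),
      (u₁ : absoluteGaloisGroup K) * (u₂ : absoluteGaloisGroup K)⁻¹ ∈ V → f u₁ = f u₂ := by
    intro u₁ u₂ h
    have h1 : f (u₁ * u₂⁻¹) = 0 := hfV _ (by simpa using h)
    have h2 : u₁ = u₁ * u₂⁻¹ * u₂ := by group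
    rw [h2, hfadd, h1, zero_add]
  -- the factorisation property of `u ↦ f (s u)`
  have hfac : ∀ (u : ↥(N ⊓ κ.layerSubgroup m)) (u' : ↥(N ⊓ κ.kerSubgroup)),
      (u : absoluteGaloisGroup K) * (u' : absoluteGaloisGroup K)⁻¹ ∈ V → f (s u) = f u' := by
    intro u u' h
    apply hwd
    have h1 : ((s u : ↥(N ⊓ κ.kerSubgroup)) : absoluteGaloisGroup K) * (u' : absoluteGaloisGroup K)⁻¹ =
        ((u : absoluteGaloisGroup K) * (s u : absoluteGaloisGroup K)⁻¹)⁻¹ *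
          ((u : absoluteGaloisGroup K) * (u' : absoluteGaloisGroup K)⁻¹) := by group
    rw [h1]
    exact mul_mem (inv_mem (hs u)) h
  refine ⟨fun u => f (s u), fun a b => ?_, hfac⟩
  -- additivity: `ab · (sa sb)⁻¹ = (a (b sb⁻¹) a⁻¹) (a sa⁻¹) ∈ V`
  have key : ((a * b : ↥(N ⊓ κ.layerSubgroup m)) : absoluteGaloisGroup K) *
      ((s a * s b : ↥(N ⊓ κ.kerSubgroup)) : absoluteGaloisGroup K)⁻¹ ∈ V := by
    have h1 : ((a * b : ↥(N ⊓ κ.layerSubgroup m)) : absoluteGaloisGroup K) *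
        ((s a * s b : ↥(N ⊓ κ.kerSubgroup)) : absoluteGaloisGroup K)⁻¹ =
        ((a : absoluteGaloisGroup K) * ((b : absoluteGaloisGroup K) * (s b : absoluteGaloisGroup K)⁻¹) *
          (a : absoluteGaloisGroup K)⁻¹) *
          ((a : absoluteGaloisGroup K) * (s a : absoluteGaloisGroup K)⁻¹) := by
      simp only [Subgroup.coe_mul, mul_inv_rev]
      group
    rw [h1]
    exact mul_mem (hVn.conj_mem _ (hs b) _) (hs a)
  change f (s (a * b)) = f (s a) + f (s b)
  rw [← hfadd]
  exact hfac _ _ key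

/-! ## §4 The extension is unramified -/

/-- Every maximal ideal of `\bar ℤ_K` lies above a finite place of `K`. [folklore] -/
private theorem exists_mem_primesAbove_of_isMaximal' (𝔓 : Ideal (absIntegers (𝓞 K) K)) [h𝔓 : 𝔓.IsMaximal] :
    ∃ v : HeightOneSpectrum (𝓞 K), 𝔓 ∈ v.primesAbove := by
  haveI : (𝔓.under (𝓞 K)).IsMaximal := Ideal.IsMaximal.under (𝓞 K) 𝔓
  have hne : 𝔓.under (𝓞 K) ≠ ⊥ :=
    Ring.ne_bot_of_isMaximal_of_not_isField inferInstance (RingOfIntegers.not_isField K)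
  exact ⟨⟨𝔓.under (𝓞 K), inferInstance, hne⟩, h𝔓.isPrime, ⟨rfl⟩⟩

/-- **Away from `p` the extension is unramified for free**: `I_𝔓 ≤ ker κ` for `𝔓 ∤ p` (`ℤ_p`-extensions are
unramified outside `p`, tree `ZpExtension.inertia_le_kerSubgroup_holds`), so on `U_m ∩ I_𝔓` the extension
`g` agrees with `f`, which kills `U_∞ ∩ I_𝔓`. [cite: Washington1997, §13.1 Prop. 13.2] -/
theorem extension_apply_eq_zero_of_not_mem (V : Subgroup (absoluteGaloisGroup K))
    (M : Type) [AddCommGroup M] [TopologicalSpace M]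
    (f : ↥(N ⊓ κ.kerSubgroup) → M)
    (hf : f ∈ unramifiedHoms (N ⊓ κ.kerSubgroup) M (∅ : Set (HeightOneSpectrum (𝓞 K))))
    (m : ℕ) (g : ↥(N ⊓ κ.layerSubgroup m) → M)
    (hg : ∀ (u : ↥(N ⊓ κ.layerSubgroup m)) (u' : ↥(N ⊓ κ.kerSubgroup)),
      (u : absoluteGaloisGroup K) * (u' : absoluteGaloisGroup K)⁻¹ ∈ V → g u = f u')
    {v : HeightOneSpectrum (𝓞 K)} (hv : ((p : ℕ) : 𝓞 K) ∉ v.asIdeal)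
    {𝔓 : Ideal (absIntegers (𝓞 K) K)} (h𝔓 : 𝔓 ∈ v.primesAbove)
    (u : ↥(N ⊓ κ.layerSubgroup m)) (hu : (u : absoluteGaloisGroup K) ∈ 𝔓.inertia (absoluteGaloisGroup K)) :
    g u = 0 := by
  have huker : (u : absoluteGaloisGroup K) ∈ κ.kerSubgroup :=
    ZpExtension.inertia_le_kerSubgroup_holds (K := K) (p := p) κ hv h𝔓 hu
  let u' : ↥(N ⊓ κ.kerSubgroup) := ⟨u, Subgroup.mem_inf.2 ⟨(Subgroup.mem_inf.1 u.2).1, huker⟩⟩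
  have hrel : (u : absoluteGaloisGroup K) * (u' : absoluteGaloisGroup K)⁻¹ ∈ V := by
    rw [show ((u' : ↥(N ⊓ κ.kerSubgroup)) : absoluteGaloisGroup K) = (u : absoluteGaloisGroup K) from rfl,
      mul_inv_cancel]
    exact V.one_mem
  have h1 : g u = f u' := hg u u' hrel
  rw [h1]
  exact hf.2.2 v (Set.notMem_empty v) 𝔓 h𝔓 u' hu

omit [NumberField K] in
/-- Conjugation moves `N ∩ κ⁻¹(p^t ℤ_p) ∩ I_{𝔓₀}` onto `N ∩ κ⁻¹(p^t ℤ_p) ∩ I_{g𝔓₀}` preserving `κ`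
(`N` and the layer subgroups are normal, `κ` is a homomorphism to an abelian group). [folklore] -/
private theorem exists_conj_mem_inertia_smul [N.Normal] (t : ℕ) (𝔓₀ : Ideal (absIntegers (𝓞 K) K))
    (g : absoluteGaloisGroup K) {σ : absoluteGaloisGroup K} (hσN : σ ∈ N ⊓ κ.layerSubgroup t)
    (hσI : σ ∈ 𝔓₀.inertia (absoluteGaloisGroup K)) :
    g * σ * g⁻¹ ∈ N ⊓ κ.layerSubgroup t ∧
      g * σ * g⁻¹ ∈ (g • 𝔓₀).inertia (absoluteGaloisGroup K) ∧ κ (g * σ * g⁻¹) = κ σ := by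
  refine ⟨(inferInstance : (N ⊓ κ.layerSubgroup t).Normal).conj_mem σ hσN g, ?_, ?_⟩
  · rw [HeightOneSpectrum.mem_inertia_smul_absIntegers_iff]
    have : g⁻¹ * (g * σ * g⁻¹) * g = σ := by group
    rw [this]; exact hσI
  · rw [map_mul, map_mul, map_inv, mul_inv_cancel_comm]

/-- **Absorption of the ramification above `p`.** For a finite place `v ∣ p` and a layer `t` there is a layer
`m_v ≥ t` such that for every `m ≥ m_v`, every prime `𝔓 ∣ v` of `\bar ℤ_K` and every
`j ∈ N ∩ κ⁻¹(p^m ℤ_p) ∩ I_𝔓`: either `κ j = 1`, or `κ j = κ (j₁^p)` for some `j₁ ∈ N ∩ κ⁻¹(p^t ℤ_p) ∩ I_𝔓`.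
(The closed subgroup `κ(N ∩ κ⁻¹(p^t) ∩ I_𝔓) ⊆ p^t ℤ_p`, independent of `𝔓 ∣ v`, is `0` or contains
`p^e ℤ_p`; take `m_v = t + e + 1`.) [cite: Washington1997, §13.1 Lemma 13.3 (eventually totally ramified)] -/
theorem exists_level_absorb_at [N.Normal] (hN : IsOpen (N : Set (absoluteGaloisGroup K)))
    (v : HeightOneSpectrum (𝓞 K)) (t : ℕ) :
    ∃ mv : ℕ, t ≤ mv ∧ ∀ m, mv ≤ m → ∀ 𝔓 ∈ v.primesAbove,
      ∀ j ∈ N ⊓ κ.layerSubgroup m, j ∈ 𝔓.inertia (absoluteGaloisGroup K) →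
        κ j = 1 ∨ ∃ j₁ ∈ N ⊓ κ.layerSubgroup t,
          j₁ ∈ 𝔓.inertia (absoluteGaloisGroup K) ∧ κ j = κ (j₁ ^ p) := by
  have hpr : p.Prime := Fact.out
  set 𝔓₀ := adicCompletionPrime K v with h𝔓₀def
  have h𝔓₀ : 𝔓₀ ∈ v.primesAbove := adicCompletionPrime_mem_primesAbove K v
  by_cases hcase : ∃ σ ∈ N ⊓ κ.layerSubgroup t, σ ∈ 𝔓₀.inertia (absoluteGaloisGroup K) ∧ κ σ ≠ 1
  · obtain ⟨σ₀, hσ₀N, hσ₀I, hσ₀⟩ := hcase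
    -- the closed subgroup `Z = κ(N ∩ layer t ∩ I_{𝔓₀})`
    set A : Subgroup (absoluteGaloisGroup K) := (N ⊓ κ.layerSubgroup t) ⊓ 𝔓₀.inertia (absoluteGaloisGroup K)
      with hAdef
    let Z : AddSubgroup ℤ_[p] :=
      AddSubgroup.toSubgroup.symm (A.map (κ.toContinuousMonoidHom : absoluteGaloisGroup K →* Multiplicative ℤ_[p]))
    have hZmem : ∀ y : ℤ_[p], y ∈ Z ↔ ∃ δ ∈ A, κ δ = Multiplicative.ofAdd y := fun y ↦ by
      change Multiplicative.ofAdd y ∈ A.map _ ↔ _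
      rw [Subgroup.mem_map]
      rfl
    have hAclosed : IsClosed (A : Set (absoluteGaloisGroup K)) := by
      rw [hAdef, Subgroup.coe_inf]
      refine IsClosed.inter ?_ (absIntegers.isClosed_inertia_holds (R := 𝓞 K) (K := K) 𝔓₀)
      exact Subgroup.isClosed_of_isOpen _ (hN.inter (κ.isOpen_layerSubgroup t))
    have hZclosed : IsClosed (Z : Set ℤ_[p]) := by
      have hc : IsCompact ((A.map
          (κ.toContinuousMonoidHom : absoluteGaloisGroup K →* Multiplicative ℤ_[p]) :
          Subgroup (Multiplicative ℤ_[p])) : Set (Multiplicative ℤ_[p])) := by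
        rw [Subgroup.coe_map]
        exact hAclosed.isCompact.image κ.toContinuousMonoidHom.continuous
      exact hc.isClosed
    set u₀ : ℤ_[p] := (κ σ₀).toAdd with hu₀def
    have hu₀0 : u₀ ≠ 0 := fun h => hσ₀ (by rw [← ofAdd_toAdd (κ σ₀), ← hu₀def, h]; rfl)
    have hu₀Z : u₀ ∈ Z := (hZmem u₀).2 ⟨σ₀, Subgroup.mem_inf.2 ⟨hσ₀N, hσ₀I⟩, by rw [hu₀def, ofAdd_toAdd]⟩
    set e := u₀.valuation with hedef
    refine ⟨t + e + 1, by omega, fun m hm 𝔓 h𝔓 j hjN hjI => Or.inr ?_⟩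
    obtain ⟨g, hg⟩ := HeightOneSpectrum.exists_smul_eq_of_mem_primesAbove_holds h𝔓₀ h𝔓
    -- `κ j = p^m z = p · (p^e · (p^(m-e-1) z))`
    obtain ⟨hjN', hjm⟩ := Subgroup.mem_inf.1 hjN
    rw [ZpExtension.mem_layerSubgroup] at hjm
    obtain ⟨z, hz⟩ := hjm
    set y : ℤ_[p] := (p : ℤ_[p]) ^ e * ((p : ℤ_[p]) ^ (m - e - 1) * z) with hydef
    have hyZ : y ∈ Z := FineSelmerCoefficientMap.pow_valuation_mul_mem_of_isClosed Z hZclosed hu₀Z hu₀0 _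
    have hjy : (κ j).toAdd = (p : ℤ_[p]) * y := by
      rw [hz, hydef]
      have hm' : m = 1 + e + (m - e - 1) := by omega
      conv_lhs => rw [hm', pow_add, pow_add, pow_one]
      ring
    obtain ⟨σ₁, hσ₁A, hσ₁⟩ := (hZmem y).1 hyZ
    obtain ⟨hσ₁N, hσ₁I⟩ := Subgroup.mem_inf.1 hσ₁A
    obtain ⟨hj₁N, hj₁I, hj₁κ⟩ := exists_conj_mem_inertia_smul κ N t 𝔓₀ g hσ₁N hσ₁I
    rw [hg] at hj₁I
    refine ⟨g * σ₁ * g⁻¹, hj₁N, hj₁I, ?_⟩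
    rw [map_pow, hj₁κ, hσ₁, ← ofAdd_nsmul, nsmul_eq_mul, ← hjy, ofAdd_toAdd]
  · refine ⟨t, le_rfl, fun m hm 𝔓 h𝔓 j hjN hjI => Or.inl ?_⟩
    obtain ⟨g, hg⟩ := HeightOneSpectrum.exists_smul_eq_of_mem_primesAbove_holds h𝔓₀ h𝔓
    have hjt : j ∈ N ⊓ κ.layerSubgroup t :=
      Subgroup.mem_inf.2 ⟨(Subgroup.mem_inf.1 hjN).1, κ.layerSubgroup_antitone hm (Subgroup.mem_inf.1 hjN).2⟩
    -- `σ = g⁻¹ j g ∈ N ∩ layer t ∩ I_{𝔓₀}`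
    have hσN : g⁻¹ * j * g ∈ N ⊓ κ.layerSubgroup t := by
      simpa only [inv_inv] using (inferInstance : (N ⊓ κ.layerSubgroup t).Normal).conj_mem j hjt g⁻¹
    have hσI : g⁻¹ * j * g ∈ 𝔓₀.inertia (absoluteGaloisGroup K) := by
      rw [← HeightOneSpectrum.mem_inertia_smul_absIntegers_iff, hg]; exact hjI
    have hσκ : κ (g⁻¹ * j * g) = κ j := by
      rw [map_mul, map_mul, map_inv, inv_mul_cancel_comm]
    by_contra hne
    exact hcase ⟨_, hσN, hσI, by rwa [hσκ]⟩

/-- `g (x ^ n) = n • g x` for an additive map on a group. [folklore] -/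
private theorem apply_pow_eq_nsmul {G : Type*} [Group G] {M : Type*} [AddCommGroup M] (g : G → M)
    (hadd : ∀ a b, g (a * b) = g a + g b) (x : G) (n : ℕ) : g (x ^ n) = n • g x := by
  induction n with
  | zero =>
    have h := hadd 1 1
    rw [mul_one, left_eq_add] at h
    rw [pow_zero, zero_smul, h]
  | succ n ih => rw [pow_succ, hadd, ih, succ_nsmul]

omit [NumberField K] in
/-- **Above `p` the extension is unramified beyond the absorption layer**: with `m ≥ m_v` as in
`exists_level_absorb_at`, an additive `g` on `N ∩ κ⁻¹(p^t)` with the factorisation property kills every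
`j ∈ N ∩ κ⁻¹(p^m) ∩ I_𝔓`, `𝔓 ∣ v`: `g j = p·g j₁ + f h = 0` with `h = j₁^{-p} j ∈ U_∞ ∩ I_𝔓` (`p·M = 0`).
[cite: CoatesSujatha2005, Thm. 3.4 (proof: the fine Selmer classes over `F_∞(E[p])` are unramified homomorphisms)] -/
theorem extension_apply_eq_zero_of_absorb [N.Normal] (V : Subgroup (absoluteGaloisGroup K))
    (M : Type) [AddCommGroup M] [TopologicalSpace M] (hpM : ∀ x : M, p • x = 0)
    (f : ↥(N ⊓ κ.kerSubgroup) → M)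
    (hf : f ∈ unramifiedHoms (N ⊓ κ.kerSubgroup) M (∅ : Set (HeightOneSpectrum (𝓞 K))))
    (t : ℕ) (g : ↥(N ⊓ κ.layerSubgroup t) → M) (hgadd : ∀ a b, g (a * b) = g a + g b)
    (hg : ∀ (u : ↥(N ⊓ κ.layerSubgroup t)) (u' : ↥(N ⊓ κ.kerSubgroup)),
      (u : absoluteGaloisGroup K) * (u' : absoluteGaloisGroup K)⁻¹ ∈ V → g u = f u')
    {v : HeightOneSpectrum (𝓞 K)} {𝔓 : Ideal (absIntegers (𝓞 K) K)} (h𝔓 : 𝔓 ∈ v.primesAbove)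
    (j : ↥(N ⊓ κ.layerSubgroup t)) (hjI : (j : absoluteGaloisGroup K) ∈ 𝔓.inertia (absoluteGaloisGroup K))
    (habs : κ (j : absoluteGaloisGroup K) = 1 ∨ ∃ j₁ ∈ N ⊓ κ.layerSubgroup t,
      j₁ ∈ 𝔓.inertia (absoluteGaloisGroup K) ∧ κ (j : absoluteGaloisGroup K) = κ (j₁ ^ p)) :
    g j = 0 := by
  rcases habs with hj1 | ⟨j₁, hj₁N, hj₁I, hjκ⟩
  · let u' : ↥(N ⊓ κ.kerSubgroup) := ⟨j, Subgroup.mem_inf.2 ⟨(Subgroup.mem_inf.1 j.2).1, hj1⟩⟩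
    have hrel : (j : absoluteGaloisGroup K) * (u' : absoluteGaloisGroup K)⁻¹ ∈ V := by
      rw [show ((u' : ↥(N ⊓ κ.kerSubgroup)) : absoluteGaloisGroup K) = (j : absoluteGaloisGroup K) from rfl,
        mul_inv_cancel]
      exact V.one_mem
    rw [hg j u' hrel]
    exact hf.2.2 v (Set.notMem_empty v) 𝔓 h𝔓 u' hjI
  · -- `h = (j₁^p)⁻¹ j ∈ U_∞ ∩ I_𝔓`
    have hhker : ((j₁ ^ p)⁻¹ * (j : absoluteGaloisGroup K)) ∈ κ.kerSubgroup := by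
      rw [ZpExtension.mem_kerSubgroup, map_mul, map_inv, ← hjκ, inv_mul_cancel]
    have hhN : ((j₁ ^ p)⁻¹ * (j : absoluteGaloisGroup K)) ∈ N :=
      mul_mem (inv_mem (pow_mem (Subgroup.mem_inf.1 hj₁N).1 p)) (Subgroup.mem_inf.1 j.2).1
    have hhI : ((j₁ ^ p)⁻¹ * (j : absoluteGaloisGroup K)) ∈ 𝔓.inertia (absoluteGaloisGroup K) :=
      mul_mem (inv_mem (pow_mem hj₁I p)) hjI
    let h' : ↥(N ⊓ κ.kerSubgroup) := ⟨(j₁ ^ p)⁻¹ * (j : absoluteGaloisGroup K), Subgroup.mem_inf.2 ⟨hhN, hhker⟩⟩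
    let hU : ↥(N ⊓ κ.layerSubgroup t) :=
      ⟨(j₁ ^ p)⁻¹ * (j : absoluteGaloisGroup K), Subgroup.mem_inf.2 ⟨hhN, κ.kerSubgroup_le_layerSubgroup t hhker⟩⟩
    let j₁U : ↥(N ⊓ κ.layerSubgroup t) := ⟨j₁, hj₁N⟩
    have hdec : j = j₁U ^ p * hU := by
      apply Subtype.ext
      rw [Subgroup.coe_mul, Subgroup.coe_pow]
      change (j : absoluteGaloisGroup K) = j₁ ^ p * ((j₁ ^ p)⁻¹ * (j : absoluteGaloisGroup K))
      rw [mul_inv_cancel_left]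
    have hrel : (hU : absoluteGaloisGroup K) * (h' : absoluteGaloisGroup K)⁻¹ ∈ V := by
      rw [show ((hU : ↥(N ⊓ κ.layerSubgroup t)) : absoluteGaloisGroup K) =
        ((h' : ↥(N ⊓ κ.kerSubgroup)) : absoluteGaloisGroup K) from rfl, mul_inv_cancel]
      exact V.one_mem
    have h1 : g hU = f h' := hg hU h' hrel
    rw [hdec, hgadd, apply_pow_eq_nsmul g hgadd, hpM, zero_add, h1]
    exact hf.2.2 v (Set.notMem_empty v) 𝔓 h𝔓 h' hhI

/-! ## §5 Assembly: finiteness of `Hom(U_∞, M; ∅)` -/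

/-- **Everywhere-unramified `p`-torsion homomorphisms on `Gal(K̄/L·K_∞)` are finite when the `p`-ranks of
the class groups of the layers `L·K_n` are bounded.** For `K` a number field, `p` odd, `κ` a `ℤ_p`-extension,
`N = Gal(K̄/L)` open normal, `M` finite with `p·M = 0`: if `[Cl(L·K_n) : Cl(L·K_n)^p] ≤ C` for every `n`
(`L·K_n = K̄^{N ∩ κ⁻¹(p^n ℤ_p)}`), then every finite subset of `unramifiedHoms (N ⊓ ker κ) M ∅` has at most
`#M ^ C` elements; hence the set is finite. Proof: §1–§4 extend the members of a finite `T` injectively to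
additive maps on `U_{m*}` killing an open normal `V ∩ U_{m*}` and every `U_{m*} ∩ I_𝔓`; the CFT count
`UnramifiedHomsClassGroupPRankBound.card_le_pow_index_of_unramified` bounds them.
[cite: CoatesSujatha2005, Thm. 3.4] [cite: KuriharaPollack2007, §3.1] [cite: Washington1997, §13.3 Prop. 13.23] -/
theorem finsetCard_le_of_subset_unramifiedHoms [N.Normal] (hN : IsOpen (N : Set (absoluteGaloisGroup K)))
    (hp : p ≠ 2) (M : Type) [AddCommGroup M] [Finite M] [TopologicalSpace M] [DiscreteTopology M]
    (hpM : ∀ x : M, p • x = 0) (C : ℕ)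
    (hC : ∀ n : ℕ, (powMonoidHom p :
        ClassGroup (𝓞 (fixedField (N ⊓ κ.layerSubgroup n) : IntermediateField K (AlgebraicClosure K))) →*
        ClassGroup (𝓞 (fixedField (N ⊓ κ.layerSubgroup n) : IntermediateField K (AlgebraicClosure K)))).range.index ≤ C)
    (T : Finset (↥(N ⊓ κ.kerSubgroup) → M))
    (hT : (T : Set (↥(N ⊓ κ.kerSubgroup) → M)) ⊆
      unramifiedHoms (N ⊓ κ.kerSubgroup) M (∅ : Set (HeightOneSpectrum (𝓞 K)))) :
    T.card ≤ Nat.card M ^ C := by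
  have hpr : p.Prime := Fact.out
  -- §1: a common open normal `V` on which all `f ∈ T` vanish
  obtain ⟨V, hV⟩ := exists_openNormalSubgroup_forall_apply_eq_zero (N ⊓ κ.kerSubgroup) M T
    (fun f hf => (hT hf).1)
    (fun f hf => by
      have h := (hT hf).2.1 1 1
      rw [mul_one, left_eq_add] at h
      exact h)
  set V' : Subgroup (absoluteGaloisGroup K) := (V : Subgroup (absoluteGaloisGroup K)) with hV'def
  haveI hV'n : V'.Normal := V.isNormal'
  have hV'open : IsOpen (V' : Set (absoluteGaloisGroup K)) := V.isOpen'
  -- §2: the decomposition layer `t`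
  obtain ⟨t, ht⟩ := exists_level_forall_exists_apply_eq κ N hN V' hV'open
  -- §4: the absorption layer `m₁ ≥ t`, uniform over the finitely many places above `p`
  have hPfin : {v : HeightOneSpectrum (𝓞 K) | ((p : ℕ) : 𝓞 K) ∈ v.asIdeal}.Finite := by
    have hp0 : (Ideal.span {((p : ℕ) : 𝓞 K)} : Ideal (𝓞 K)) ≠ ⊥ := by
      rw [Ne, Ideal.span_singleton_eq_bot]
      exact_mod_cast hpr.ne_zero
    refine (Ideal.finite_factors hp0).subset fun v hv => ?_
    exact (Ideal.dvd_span_singleton.2 hv : v.asIdeal ∣ Ideal.span {((p : ℕ) : 𝓞 K)})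
  have habs : ∀ v : HeightOneSpectrum (𝓞 K), ∃ mv : ℕ, t ≤ mv ∧ ∀ m, mv ≤ m → ∀ 𝔓 ∈ v.primesAbove,
      ∀ j ∈ N ⊓ κ.layerSubgroup m, j ∈ 𝔓.inertia (absoluteGaloisGroup K) →
        κ j = 1 ∨ ∃ j₁ ∈ N ⊓ κ.layerSubgroup t,
          j₁ ∈ 𝔓.inertia (absoluteGaloisGroup K) ∧ κ j = κ (j₁ ^ p) :=
    fun v => exists_level_absorb_at κ N hN v t
  choose mv hmvt hmv using habs
  -- `m₁` is obtained existentially (opaque to the kernel: no unfolding of the finite set of places above `p`)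
  obtain ⟨m₁, hm₁t, hm₁v⟩ : ∃ m₁ : ℕ, t ≤ m₁ ∧
      ∀ v : HeightOneSpectrum (𝓞 K), ((p : ℕ) : 𝓞 K) ∈ v.asIdeal → mv v ≤ m₁ :=
    ⟨max t (hPfin.toFinset.sup mv), le_max_left _ _, fun v hv =>
      (Finset.le_sup (f := mv) (hPfin.mem_toFinset.2 hv)).trans (le_max_right _ _)⟩
  -- §3: the extensions at level `t`, restricted to level `m₁`
  have hext : ∀ f ∈ T, ∃ g : ↥(N ⊓ κ.layerSubgroup t) → M,
      (∀ a b, g (a * b) = g a + g b) ∧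
      (∀ (u : ↥(N ⊓ κ.layerSubgroup t)) (u' : ↥(N ⊓ κ.kerSubgroup)),
        (u : absoluteGaloisGroup K) * (u' : absoluteGaloisGroup K)⁻¹ ∈ V' → g u = f u') :=
    fun f hf => exists_extension κ N V' M f (hT hf).2.1 (hV f hf) t (ht t le_rfl)
  obtain ⟨gext, hgadd, hgfac⟩ : ∃ gext : (↥(N ⊓ κ.kerSubgroup) → M) → (↥(N ⊓ κ.layerSubgroup t) → M),
      (∀ f ∈ T, ∀ a b, gext f (a * b) = gext f a + gext f b) ∧
      (∀ f ∈ T, ∀ (u : ↥(N ⊓ κ.layerSubgroup t)) (u' : ↥(N ⊓ κ.kerSubgroup)),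
        (u : absoluteGaloisGroup K) * (u' : absoluteGaloisGroup K)⁻¹ ∈ V' → gext f u = f u') := by
    choose! gext hgadd hgfac using hext
    exact ⟨gext, hgadd, hgfac⟩
  set U : Subgroup (absoluteGaloisGroup K) := N ⊓ κ.layerSubgroup m₁ with hUdef
  have hUt : U ≤ N ⊓ κ.layerSubgroup t :=
    inf_le_inf_left N (κ.layerSubgroup_antitone hm₁t)
  haveI hUn : U.Normal := inferInstance
  have hUopen : IsOpen (U : Set (absoluteGaloisGroup K)) := hN.inter (κ.isOpen_layerSubgroup m₁)
  set W : Subgroup (absoluteGaloisGroup K) := V' ⊓ U with hWdef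
  haveI hWn : W.Normal := inferInstance
  have hWopen : IsOpen (W : Set (absoluteGaloisGroup K)) := hV'open.inter hUopen
  have hWU : W ≤ U := inf_le_right
  obtain ⟨G, hG⟩ : ∃ G : (↥(N ⊓ κ.kerSubgroup) → M) → (U → M),
      ∀ f u, G f u = gext f (Subgroup.inclusion hUt u) := ⟨_, fun _ _ => rfl⟩
  -- the extended maps restrict to the given ones: `G` is injective on `T`
  have hGres : ∀ f ∈ T, ∀ (u' : ↥(N ⊓ κ.kerSubgroup)) (hu : (u' : absoluteGaloisGroup K) ∈ U),
      G f ⟨u', hu⟩ = f u' := by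
    intro f hf u' hu
    rw [hG]
    refine hgfac f hf _ u' ?_
    rw [Subgroup.coe_inclusion, mul_inv_cancel]
    exact V'.one_mem
  have hGinj : Set.InjOn G T := by
    intro f₁ hf₁ f₂ hf₂ h
    funext u'
    have hu : ((u' : ↥(N ⊓ κ.kerSubgroup)) : absoluteGaloisGroup K) ∈ U :=
      Subgroup.mem_inf.2 ⟨(Subgroup.mem_inf.1 u'.2).1,
        κ.kerSubgroup_le_layerSubgroup m₁ (Subgroup.mem_inf.1 u'.2).2⟩
    rw [← hGres f₁ hf₁ u' hu, ← hGres f₂ hf₂ u' hu, h]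
  -- §4: every `G f` kills `W` and every `U ∩ I_𝔓`
  have hGadd : ∀ g ∈ T.image G, ∀ u v : U, g (u * v) = g u + g v := by
    intro g hg u v
    obtain ⟨f, hf, rfl⟩ := Finset.mem_image.1 hg
    rw [hG, hG, hG, map_mul]
    exact hgadd f hf _ _
  have hGW : ∀ g ∈ T.image G, ∀ u : U, (u : absoluteGaloisGroup K) ∈ W → g u = 0 := by
    intro g hg u hu
    obtain ⟨f, hf, rfl⟩ := Finset.mem_image.1 hg
    have h1 : G f u = f 1 := by
      rw [hG]
      refine hgfac f hf _ 1 ?_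
      rw [Subgroup.coe_inclusion, Subgroup.coe_one, inv_one, mul_one]
      exact (Subgroup.mem_inf.1 hu).1
    rw [h1]
    have h := (hT hf).2.1 1 1
    rw [mul_one, left_eq_add] at h
    exact h
  have hGI : ∀ g ∈ T.image G, ∀ (𝔓 : Ideal (absIntegers (𝓞 K) K)), 𝔓.IsMaximal →
      ∀ u : U, (u : absoluteGaloisGroup K) ∈ 𝔓.inertia (absoluteGaloisGroup K) → g u = 0 := by
    intro g hg 𝔓 h𝔓max u hu
    obtain ⟨f, hf, rfl⟩ := Finset.mem_image.1 hg
    obtain ⟨v, h𝔓⟩ := exists_mem_primesAbove_of_isMaximal' 𝔓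
    rw [hG]
    -- transport the hypotheses on `u` to `inclusion u` through the LEMMA `coe_inclusion` (never by `rfl`:
    -- the two subtypes differ and the kernel's definitional check is prohibitively slow)
    have hcoe : ((Subgroup.inclusion hUt u : ↥(N ⊓ κ.layerSubgroup t)) : absoluteGaloisGroup K) =
        (u : absoluteGaloisGroup K) := Subgroup.coe_inclusion hUt u
    have hu' : ((Subgroup.inclusion hUt u : ↥(N ⊓ κ.layerSubgroup t)) : absoluteGaloisGroup K) ∈
        𝔓.inertia (absoluteGaloisGroup K) := by rw [hcoe]; exact hu
    by_cases hv : ((p : ℕ) : 𝓞 K) ∈ v.asIdeal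
    · have habs := hmv v m₁ (hm₁v v hv) 𝔓 h𝔓 u u.2 hu
      rw [← hcoe] at habs
      exact extension_apply_eq_zero_of_absorb κ N V' M hpM f (hT hf) t (gext f) (hgadd f hf) (hgfac f hf)
        h𝔓 (Subgroup.inclusion hUt u) hu' habs
    · exact extension_apply_eq_zero_of_not_mem κ N V' M f (hT hf) t (gext f) (hgfac f hf) hv h𝔓
        (Subgroup.inclusion hUt u) hu'
  -- §5: the class-field-theoretic count
  have hcount := UnramifiedHomsClassGroupPRankBound.card_le_pow_index_of_unramified p U W hp hUopen hWopen
    hWU M hpM (T.image G) hGadd hGW hGI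
  rw [Finset.card_image_of_injOn hGinj] at hcount
  have hMpos : 0 < Nat.card M := Nat.card_pos
  exact hcount.trans (Nat.pow_le_pow_right hMpos (hC m₁))

/-- **Coates–Sujatha Thm. 3.4, group-theoretic core (bounded-`p`-rank form).** Under the hypotheses of
`finsetCard_le_of_subset_unramifiedHoms`, `unramifiedHoms (N ⊓ ker κ) M ∅` is FINITE.
[cite: CoatesSujatha2005, Thm. 3.4] [cite: KuriharaPollack2007, §3.1] -/
theorem unramifiedHoms_finite_of_index_le [N.Normal] (hN : IsOpen (N : Set (absoluteGaloisGroup K)))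
    (hp : p ≠ 2) (M : Type) [AddCommGroup M] [Finite M] [TopologicalSpace M] [DiscreteTopology M]
    (hpM : ∀ x : M, p • x = 0) (C : ℕ)
    (hC : ∀ n : ℕ, (powMonoidHom p :
        ClassGroup (𝓞 (fixedField (N ⊓ κ.layerSubgroup n) : IntermediateField K (AlgebraicClosure K))) →*
        ClassGroup (𝓞 (fixedField (N ⊓ κ.layerSubgroup n) : IntermediateField K (AlgebraicClosure K)))).range.index ≤ C) :
    (unramifiedHoms (N ⊓ κ.kerSubgroup) M (∅ : Set (HeightOneSpectrum (𝓞 K)))).Finite := by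
  by_contra hinf
  obtain ⟨T, hTsub, hTcard⟩ := Set.Infinite.exists_subset_card_eq hinf (Nat.card M ^ C + 1)
  have := finsetCard_le_of_subset_unramifiedHoms κ N hN hp M hpM C hC T hTsub
  omega

end Literature.NumberTheory.IwasawaTheory.UnramifiedHomsZpTowerFinite

end
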